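import Summits.Parity.GeneralizedHardyLittlewood.Theorems.GreenTaoLevelTwoMNTwoRotationBohrDoubling

/-!
# Route `GreenTaoLevelTwo`, crux `MNTwo` (stmt-Parity-21276), line `birth`, stub `stub_mnVertical`:
# multiples of `d` in rotation Bohr sets (GT 2008b Lemma 14 (c))

Brick for blocks V2–V6 of the `stub_mnVertical` census (B. Green, T. Tao, *Quadratic uniformity of the
Möbius function*, Ann. Inst. Fourier 58 (2008) = arXiv:math/0606087, §6 Lemma 14 (c): "For any integer
`d ≥ 1` we have `|{n ∈ B_g(0,ρ) : d | n}| ≫_{G/Γ} d⁻¹ |B_g(0,ρ)|` … By the pigeonhole principle there is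
some residue class … for which `|B_g(0,ρ/2) ∩ X_b| ≥ d⁻¹|B_g(0,ρ/2)|` … if `n, n₀ ∈ B_g(0,ρ/2) ∩ X_b` then
`d | (n − n₀)` and `n − n₀ ∈ B_g(0,ρ)`. The result now follows from (b)").  Def-free, explicit constant:

* `card_rotationBohr_dvd_ge` — `#B_α(0,ρ) ≤ 32 · 38ᵏ · d · #{n ∈ B_α(0,ρ) : d ∣ n}` for `0 < ρ ≤ 1/2`.

References: [GreenTao2008QuadraticMobius] arXiv:math/0606087 §6, Lemma 14 (c).
-/

noncomputable section

open Finset Real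

namespace Summit.Parity.GeneralizedHardyLittlewood.GreenTaoLevelTwoMNTwoRotationBohrDivisible

open Summit.Parity.GeneralizedHardyLittlewood.GreenTaoLevelTwoMNTwoRotationBohrDoubling
  (card_rotationBohr_two_mul_le)

/-- **Multiples of `d` in a rotation Bohr set (GT 2008b Lemma 14 (c)).**  For `N ≥ 1`, `α ∈ ℝᵏ`,
`0 < ρ ≤ 1/2` and `d ≥ 1`: `#B_α(0,ρ) ≤ 32 · 38ᵏ · d · #{n ∈ B_α(0,ρ) : d ∣ n}`.
[cite: GreenTao2008QuadraticMobius, Lemma 14 (c)] -/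
theorem card_rotationBohr_dvd_ge (k : ℕ) {N : ℕ} (hN : 1 ≤ N) (α : Fin k → ℝ) {ρ : ℝ}
    (hρ : 0 < ρ) (hρ2 : ρ ≤ 1 / 2) {d : ℕ} (hd : 1 ≤ d) :
    (#((Finset.Ioo (-(N : ℤ)) N).filter fun n : ℤ =>
        (∀ i, ‖(((n : ℝ) * α i : ℝ) : AddCircle (1 : ℝ))‖ + |(n : ℝ)| / N < ρ) ∧ |(n : ℝ)| / N < ρ) : ℝ) ≤
      32 * 38 ^ k * d * #((Finset.Ioo (-(N : ℤ)) N).filter fun n : ℤ =>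
        ((∀ i, ‖(((n : ℝ) * α i : ℝ) : AddCircle (1 : ℝ))‖ + |(n : ℝ)| / N < ρ) ∧ |(n : ℝ)| / N < ρ) ∧
          (d : ℤ) ∣ n) := by
  classical
  have hNpos : (0 : ℝ) < N := by exact_mod_cast hN
  set B := (Finset.Ioo (-(N : ℤ)) N).filter fun n : ℤ =>
    (∀ i, ‖(((n : ℝ) * α i : ℝ) : AddCircle (1 : ℝ))‖ + |(n : ℝ)| / N < ρ) ∧ |(n : ℝ)| / N < ρ with hB
  set Bd := (Finset.Ioo (-(N : ℤ)) N).filter fun n : ℤ =>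
    ((∀ i, ‖(((n : ℝ) * α i : ℝ) : AddCircle (1 : ℝ))‖ + |(n : ℝ)| / N < ρ) ∧ |(n : ℝ)| / N < ρ) ∧
      (d : ℤ) ∣ n with hBd
  set Bh := (Finset.Ioo (-(N : ℤ)) N).filter fun n : ℤ =>
    (∀ i, ‖(((n : ℝ) * α i : ℝ) : AddCircle (1 : ℝ))‖ + |(n : ℝ)| / N < ρ / 2) ∧ |(n : ℝ)| / N < ρ / 2
    with hBh
  -- (b) with `ρ/2`: `#B ≤ 32·38ᵏ #Bh`
  have hdouble : (#B : ℝ) ≤ 32 * 38 ^ k * #Bh := by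
    have h := card_rotationBohr_two_mul_le k hN α (ρ := ρ / 2) (by positivity) (by linarith)
    have e : 2 * (ρ / 2) = ρ := by ring
    simp only [e] at h
    exact h
  -- pigeonhole on residues mod `d` in `Bh`
  have hdpos : (0 : ℤ) < d := by exact_mod_cast hd
  have h0Bh : (0 : ℤ) ∈ Bh := by
    rw [hBh, mem_filter, mem_Ioo]
    refine ⟨⟨by omega, by omega⟩, fun i => ?_, by simp; positivity⟩
    simp; positivity
  set g : ℤ → ℤ := fun n => n % d with hg
  have hmaps : ∀ n ∈ Bh, g n ∈ Finset.Ico (0 : ℤ) d := fun n _ => by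
    rw [mem_Ico]; exact ⟨Int.emod_nonneg _ hdpos.ne', Int.emod_lt_of_pos _ hdpos⟩
  have hcardI : #(Finset.Ico (0 : ℤ) d) = d := by simp
  set m : ℕ := (#Bh - 1) / d with hm
  have hmul : #(Finset.Ico (0 : ℤ) d) * m < #Bh := by
    rw [hcardI]
    have h1 : 1 ≤ #Bh := card_pos.2 ⟨0, h0Bh⟩
    calc d * ((#Bh - 1) / d) ≤ #Bh - 1 := by rw [mul_comm]; exact Nat.div_mul_le_self _ _
      _ < #Bh := by omega
  obtain ⟨y, -, hfib⟩ := Finset.exists_lt_card_fiber_of_mul_lt_card_of_maps_to hmaps hmul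
  set S : Finset ℤ := Bh.filter fun n => g n = y with hS
  have hSm : m < #S := hfib
  have hSne : S.Nonempty := card_pos.1 (lt_of_le_of_lt (Nat.zero_le m) hSm)
  obtain ⟨n₀, hn₀⟩ := hSne
  have hmemS : ∀ {n}, n ∈ S → n ∈ Bh ∧ n % d = y := fun hn => by
    rw [hS, mem_filter] at hn; exact hn
  have hmemBh : ∀ {n : ℤ}, n ∈ Bh → (∀ i, ‖(((n : ℝ) * α i : ℝ) : AddCircle (1 : ℝ))‖ + |(n : ℝ)| / N < ρ / 2)
      ∧ |(n : ℝ)| / N < ρ / 2 := fun hn => by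
    rw [hBh, mem_filter] at hn; exact hn.2
  -- `S - n₀ ⊆ Bd`
  have hsub : ∀ n ∈ S, n - n₀ ∈ Bd := by
    intro n hn
    obtain ⟨hnB, hny⟩ := hmemS hn
    obtain ⟨hn₀B, hn₀y⟩ := hmemS hn₀
    obtain ⟨htn, hin⟩ := hmemBh hnB
    obtain ⟨htn₀, hin₀⟩ := hmemBh hn₀B
    have hdvd : (d : ℤ) ∣ n - n₀ := by
      rw [Int.dvd_iff_emod_eq_zero, Int.sub_emod, hny, hn₀y, sub_self, Int.zero_emod]
    have habs : |((n : ℝ) - n₀)| / N < ρ := by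
      rw [div_lt_iff₀ hNpos]
      rw [div_lt_iff₀ hNpos] at hin hin₀
      calc |((n : ℝ) - n₀)| ≤ |(n : ℝ)| + |(n₀ : ℝ)| := abs_sub _ _
        _ < ρ / 2 * N + ρ / 2 * N := add_lt_add hin hin₀
        _ = ρ * N := by ring
    have htor : ∀ i, ‖((((n : ℝ) - n₀) * α i : ℝ) : AddCircle (1 : ℝ))‖ + |((n : ℝ) - n₀)| / N < ρ := by
      intro i
      have h1 := htn i
      have h2 := htn₀ i
      rw [div_lt_iff₀ hNpos] at hin hin₀
      have h3 : ‖((((n : ℝ) - n₀) * α i : ℝ) : AddCircle (1 : ℝ))‖ ≤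
          ‖(((n : ℝ) * α i : ℝ) : AddCircle (1 : ℝ))‖ + ‖(((n₀ : ℝ) * α i : ℝ) : AddCircle (1 : ℝ))‖ := by
        rw [sub_mul, AddCircle.coe_sub]; exact norm_sub_le _ _
      have h4 : |((n : ℝ) - n₀)| / N ≤ |(n : ℝ)| / N + |(n₀ : ℝ)| / N := by
        rw [← add_div]; exact div_le_div_of_nonneg_right (abs_sub _ _) hNpos.le
      linarith
    have hNr : |((n : ℝ) - n₀)| < N := by
      rw [div_lt_iff₀ hNpos] at habs; nlinarith
    have hnI : (-(N : ℤ)) < n - n₀ ∧ n - n₀ < N := by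
      have h1 := abs_lt.1 hNr
      constructor
      · have : (-(N : ℝ)) < (n : ℝ) - n₀ := h1.1
        exact_mod_cast this
      · have : (n : ℝ) - n₀ < N := h1.2
        exact_mod_cast this
    rw [hBd, mem_filter, mem_Ioo]
    refine ⟨hnI, ⟨fun i => ?_, ?_⟩, hdvd⟩
    · have := htor i; push_cast; exact this
    · push_cast; exact habs
  have hinj : Set.InjOn (fun n : ℤ => n - n₀) S := fun a _ b _ h => by simpa using h
  have hcardS : #S ≤ #Bd := by
    rw [← card_image_of_injOn hinj]
    exact card_le_card fun z hz => by
      obtain ⟨n, hn, rfl⟩ := mem_image.1 hz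
      exact hsub n hn
  -- `#Bh ≤ d (m+1) ≤ d #S ≤ d #Bd`
  have hdpos' : 0 < d := hd
  have h1 : #Bh - 1 < m * d + d := by rw [hm]; exact Nat.lt_div_mul_add hdpos'
  have h2 : #Bh ≤ d * #S := by
    have h3 : #Bh ≤ d * (m + 1) := by
      have := card_pos.2 ⟨(0 : ℤ), h0Bh⟩
      rw [Nat.mul_add, Nat.mul_one, Nat.mul_comm]; omega
    exact h3.trans (Nat.mul_le_mul_left _ hSm)
  have h2r : (#Bh : ℝ) ≤ d * #Bd := by
    have : #Bh ≤ d * #Bd := h2.trans (Nat.mul_le_mul_left _ hcardS)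
    exact_mod_cast this
  calc (#B : ℝ) ≤ 32 * 38 ^ k * #Bh := hdouble
    _ ≤ 32 * 38 ^ k * (d * #Bd) := mul_le_mul_of_nonneg_left h2r (by positivity)
    _ = 32 * 38 ^ k * d * #Bd := by ring

end Summit.Parity.GeneralizedHardyLittlewood.GreenTaoLevelTwoMNTwoRotationBohrDivisible
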